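import Mathlib
import HarnessLib

/-!
# Route SliceSignRank — support item `SignRankLinearLower` (stmt-ValiantsHypothesis-15122):
# Pólya on `S_3` and the rank-one elimination

Two route-independent lemmas behind `SignRankLinearLower` (`k` real twists sign-representing `sgn`
on `S_n` force `n ≤ 3k`):

* `slice_admissible` — **Pólya on `S_3`.** A 3×3 slice function `h(ρ) = Π_a M(ρ a, a)` either
  vanishes at some `ρ ∈ S_3`, or there are `ρ, ρ'` with `h(ρ) h(ρ') sgn(ρ) sgn(ρ') < 0` (i.e.
  `sign h · sgn` is not constant): the three even permutations partition the nine cells and so do the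
  three odd ones, so `Π_even h = Π_cells M = Π_odd h`, which is impossible when `sign h = ± sgn`.
* `elimination` — **rank-one elimination.** If `Σ_{t ∈ T} c_t Π_{j<m} h_{t,j}(ρ_j)` has the strict
  sign `ε · Π_j sgn ρ_j` on all of `S_3^m` and every `h_{t,j}` is admissible in the above sense, then
  `m + 1 ≤ |T|`: one term is killed per block, at a zero `ρ₀` of `h_{t₁,0}` by restriction, otherwise
  by the combination `h_{t₁,0}(ρ') F(ρ, ·) − h_{t₁,0}(ρ) F(ρ', ·)` whose two summands have the same
  strict sign pattern because `sign h(ρ') sgn ρ' = − sign h(ρ) sgn ρ`.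

Pure finite combinatorics over `ℝ`; no route file is imported (the closing file
`SliceSignRankSignRankLinearLower.lean` does the block embedding `S_3^{⌊n/3⌋} ↪ S_n`).
Honest framing: an elementary sign-rank lower bound; nothing here bears on VP ≠ VNP.
-/

set_option linter.dupNamespace false

noncomputable section

namespace Summit.ValiantsHypothesis.ValiantsHypothesis.Theorems.SliceSignRank

open Equiv Finset

/-! ## Signs as reals -/

/-- The sign of a permutation, as a real number, is `1` or `-1`. [folklore] -/
theorem sign_real_eq_one_or {α : Type*} [Fintype α] [DecidableEq α] (ρ : Perm α) :
    ((Perm.sign ρ : ℤ) : ℝ) = 1 ∨ ((Perm.sign ρ : ℤ) : ℝ) = -1 := by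
  rcases Int.units_eq_one_or (Perm.sign ρ) with h | h
  · left; rw [h]; simp
  · right; rw [h]; simp

/-- `sgn(ρ)² = 1` over `ℝ`. [folklore] -/
theorem sign_real_mul_self {α : Type*} [Fintype α] [DecidableEq α] (ρ : Perm α) :
    ((Perm.sign ρ : ℤ) : ℝ) * ((Perm.sign ρ : ℤ) : ℝ) = 1 := by
  rcases sign_real_eq_one_or ρ with h | h <;> rw [h] <;> norm_num

/-! ## Pólya on `S_3` -/

/-- The 3-cycle `(0 1 2)` of `Fin 3` as a product of transpositions. [folklore] -/
theorem three_cycle_apply :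
    (swap (0 : Fin 3) 1 * swap (1 : Fin 3) 2) 0 = 1 ∧ (swap (0 : Fin 3) 1 * swap (1 : Fin 3) 2) 1 = 2 ∧
      (swap (0 : Fin 3) 1 * swap (1 : Fin 3) 2) 2 = 0 := by
  refine ⟨?_, ?_, ?_⟩ <;> decide

/-- The inverse 3-cycle `(0 2 1)`. [folklore] -/
theorem three_cycle_inv_apply :
    (swap (1 : Fin 3) 2 * swap (0 : Fin 3) 1) 0 = 2 ∧ (swap (1 : Fin 3) 2 * swap (0 : Fin 3) 1) 1 = 0 ∧
      (swap (1 : Fin 3) 2 * swap (0 : Fin 3) 1) 2 = 1 := by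
  refine ⟨?_, ?_, ?_⟩ <;> decide

/-- **Pólya on `S_3`.** A slice function `ρ ↦ Π_a M(ρ a, a)` of a real `3 × 3` matrix either has a
zero on `S_3` or takes, at two permutations `ρ, ρ'`, values with `h(ρ) h(ρ') sgn ρ sgn ρ' < 0`
(the even and the odd permutations each partition the nine cells, so the product of the three even
values equals the product of the three odd values; were `sign h · sgn` constant these two products
would have opposite signs). [folklore] -/
theorem slice_admissible (M : Matrix (Fin 3) (Fin 3) ℝ) :
    (∃ ρ : Perm (Fin 3), ∏ a, M (ρ a) a = 0) ∨
      ∃ ρ ρ' : Perm (Fin 3), (∏ a, M (ρ a) a) * (∏ a, M (ρ' a) a) *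
        ((Perm.sign ρ : ℤ) : ℝ) * ((Perm.sign ρ' : ℤ) : ℝ) < 0 := by
  by_contra hcon
  push Not at hcon
  obtain ⟨hnz, hpair⟩ := hcon
  -- signs of the six permutations (`c = (0 1 2)`, `c' = (0 2 1)`, three transpositions)
  have hsc : ((Perm.sign (swap (0 : Fin 3) 1 * swap (1 : Fin 3) 2) : ℤ) : ℝ) = 1 := by
    rw [Perm.sign_mul, Perm.sign_swap (by decide), Perm.sign_swap (by decide)]; norm_num
  have hsc' : ((Perm.sign (swap (1 : Fin 3) 2 * swap (0 : Fin 3) 1) : ℤ) : ℝ) = 1 := by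
    rw [Perm.sign_mul, Perm.sign_swap (by decide), Perm.sign_swap (by decide)]; norm_num
  have hs01 : ((Perm.sign (swap (0 : Fin 3) 1) : ℤ) : ℝ) = -1 := by
    rw [Perm.sign_swap (by decide)]; norm_num
  have hs02 : ((Perm.sign (swap (0 : Fin 3) 2) : ℤ) : ℝ) = -1 := by
    rw [Perm.sign_swap (by decide)]; norm_num
  have hs12 : ((Perm.sign (swap (1 : Fin 3) 2) : ℤ) : ℝ) = -1 := by
    rw [Perm.sign_swap (by decide)]; norm_num
  have hs1 : ((Perm.sign (1 : Perm (Fin 3)) : ℤ) : ℝ) = 1 := by rw [Perm.sign_one]; norm_num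
  -- the six values
  set f : Perm (Fin 3) → ℝ := fun ρ => ∏ a, M (ρ a) a with hf
  have hf1 : f 1 = M 0 0 * M 1 1 * M 2 2 := by
    simp only [hf, Fin.prod_univ_three, Perm.one_apply]
  have hfc : f (swap (0 : Fin 3) 1 * swap (1 : Fin 3) 2) = M 1 0 * M 2 1 * M 0 2 := by
    simp only [hf, Fin.prod_univ_three, three_cycle_apply.1, three_cycle_apply.2.1,
      three_cycle_apply.2.2]
  have hfc' : f (swap (1 : Fin 3) 2 * swap (0 : Fin 3) 1) = M 2 0 * M 0 1 * M 1 2 := by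
    simp only [hf, Fin.prod_univ_three, three_cycle_inv_apply.1, three_cycle_inv_apply.2.1,
      three_cycle_inv_apply.2.2]
  have hf01 : f (swap (0 : Fin 3) 1) = M 1 0 * M 0 1 * M 2 2 := by
    simp only [hf, Fin.prod_univ_three, swap_apply_left, swap_apply_right,
      swap_apply_of_ne_of_ne (show (2 : Fin 3) ≠ 0 by decide) (show (2 : Fin 3) ≠ 1 by decide)]
  have hf02 : f (swap (0 : Fin 3) 2) = M 2 0 * M 1 1 * M 0 2 := by
    simp only [hf, Fin.prod_univ_three, swap_apply_left, swap_apply_right,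
      swap_apply_of_ne_of_ne (show (1 : Fin 3) ≠ 0 by decide) (show (1 : Fin 3) ≠ 2 by decide)]
  have hf12 : f (swap (1 : Fin 3) 2) = M 0 0 * M 2 1 * M 1 2 := by
    simp only [hf, Fin.prod_univ_three, swap_apply_left, swap_apply_right,
      swap_apply_of_ne_of_ne (show (0 : Fin 3) ≠ 1 by decide) (show (0 : Fin 3) ≠ 2 by decide)]
  -- even and odd products agree
  have hEO : f 1 * f (swap (0 : Fin 3) 1 * swap (1 : Fin 3) 2) * f (swap (1 : Fin 3) 2 * swap (0 : Fin 3) 1) =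
      f (swap (0 : Fin 3) 1) * f (swap (0 : Fin 3) 2) * f (swap (1 : Fin 3) 2) := by
    rw [hf1, hfc, hfc', hf01, hf02, hf12]; ring
  -- pairwise sign agreement of `u = f · sgn`
  have hu : ∀ ρ : Perm (Fin 3), 0 < f 1 * (f ρ * ((Perm.sign ρ : ℤ) : ℝ)) := by
    intro ρ
    have h0 := hpair 1 ρ
    have hne : f 1 * (f ρ * ((Perm.sign ρ : ℤ) : ℝ)) ≠ 0 := by
      refine mul_ne_zero (hnz 1) (mul_ne_zero (hnz ρ) ?_)
      rcases sign_real_eq_one_or ρ with h | h <;> rw [h] <;> norm_num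
    have h0' : 0 ≤ f 1 * (f ρ * ((Perm.sign ρ : ℤ) : ℝ)) := by
      have : (∏ a, M ((1 : Perm (Fin 3)) a) a) * (∏ a, M (ρ a) a) *
          ((Perm.sign (1 : Perm (Fin 3)) : ℤ) : ℝ) * ((Perm.sign ρ : ℤ) : ℝ) =
          f 1 * (f ρ * ((Perm.sign ρ : ℤ) : ℝ)) := by rw [hs1]; simp only [hf]; ring
      rw [← this]; exact h0
    exact lt_of_le_of_ne h0' (Ne.symm hne)
  have huc := hu (swap (0 : Fin 3) 1 * swap (1 : Fin 3) 2)
  have huc' := hu (swap (1 : Fin 3) 2 * swap (0 : Fin 3) 1)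
  have hu01 := hu (swap (0 : Fin 3) 1)
  have hu02 := hu (swap (0 : Fin 3) 2)
  have hu12 := hu (swap (1 : Fin 3) 2)
  rw [hsc] at huc; rw [hsc'] at huc'; rw [hs01] at hu01; rw [hs02] at hu02; rw [hs12] at hu12
  have hf1sq : 0 < f 1 * f 1 := mul_self_pos.2 (hnz 1)
  -- `f 1 ^ 3 · (E + O')` is a sum of two positive products, yet `E = O = -O'`
  have hP1 := mul_pos (mul_pos hf1sq huc) huc'
  have hP2 := mul_pos (mul_pos hu01 hu02) hu12
  have hid : (f 1 * f 1) * (f 1 * (f (swap (0 : Fin 3) 1 * swap (1 : Fin 3) 2) * 1)) *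
        (f 1 * (f (swap (1 : Fin 3) 2 * swap (0 : Fin 3) 1) * 1)) +
      (f 1 * (f (swap (0 : Fin 3) 1) * (-1))) * (f 1 * (f (swap (0 : Fin 3) 2) * (-1))) *
        (f 1 * (f (swap (1 : Fin 3) 2) * (-1))) =
      f 1 * f 1 * f 1 * (f 1 * f (swap (0 : Fin 3) 1 * swap (1 : Fin 3) 2) *
        f (swap (1 : Fin 3) 2 * swap (0 : Fin 3) 1) -
        f (swap (0 : Fin 3) 1) * f (swap (0 : Fin 3) 2) * f (swap (1 : Fin 3) 2)) := by ring
  rw [hEO, sub_self, mul_zero] at hid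
  linarith

/-! ## Rank-one elimination -/

/-- **Rank-one elimination.** Let `T` be a finite set of terms, `c : T → ℝ`, and
`h t j : S_3 → ℝ` (`j < m`) functions each of which has a zero or two values with
`h(ρ) h(ρ') sgn ρ sgn ρ' < 0`. If `Σ_{t∈T} c_t Π_j h_{t,j}(ρ_j)` has the strict sign
`ε Π_j sgn ρ_j` (`ε = ±1`) at every `ρ ∈ S_3^m`, then `m + 1 ≤ |T|`. [folklore] -/
theorem elimination (m : ℕ) :
    ∀ {ι : Type} [DecidableEq ι] (T : Finset ι) (c : ι → ℝ) (h : ι → Fin m → Perm (Fin 3) → ℝ)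
      (ε : ℝ), (ε = 1 ∨ ε = -1) →
      (∀ t ∈ T, ∀ j, (∃ ρ, h t j ρ = 0) ∨
        ∃ ρ ρ', h t j ρ * h t j ρ' * ((Perm.sign ρ : ℤ) : ℝ) * ((Perm.sign ρ' : ℤ) : ℝ) < 0) →
      (∀ σ : Fin m → Perm (Fin 3),
        0 < ε * (∏ j, ((Perm.sign (σ j) : ℤ) : ℝ)) * ∑ t ∈ T, c t * ∏ j, h t j (σ j)) →
      m + 1 ≤ T.card := by
  induction m with
  | zero =>
    intro ι _ T c h ε _ _ hpos
    by_contra hT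
    have hT0 : T = ∅ := by
      rw [← Finset.card_eq_zero]; omega
    have := hpos (fun j => 1)
    rw [hT0, Finset.sum_empty, mul_zero] at this
    exact lt_irrefl _ this
  | succ m ih =>
    intro ι _ T c h ε hε hadm hpos
    classical
    -- `T` is nonempty
    have hne : T.Nonempty := by
      rw [Finset.nonempty_iff_ne_empty]
      rintro rfl
      have := hpos (fun _ => 1)
      rw [Finset.sum_empty, mul_zero] at this
      exact lt_irrefl _ this
    obtain ⟨t₁, ht₁⟩ := hne
    have hcard : (T.erase t₁).card + 1 = T.card := Finset.card_erase_add_one ht₁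
    -- splitting a sum over `T` whose `t₁`-term vanishes
    have hsplit : ∀ g : ι → ℝ, g t₁ = 0 → ∑ t ∈ T.erase t₁, g t = ∑ t ∈ T, g t := by
      intro g hg
      rw [← Finset.add_sum_erase T g ht₁, hg, zero_add]
    -- evaluating the hypothesis at `Fin.cons ρ σ'`
    have heval : ∀ (ρ : Perm (Fin 3)) (σ' : Fin m → Perm (Fin 3)),
        0 < ε * ((Perm.sign ρ : ℤ) : ℝ) * (∏ j, ((Perm.sign (σ' j) : ℤ) : ℝ)) *
          ∑ t ∈ T, c t * h t 0 ρ * ∏ j, h t j.succ (σ' j) := by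
      intro ρ σ'
      have := hpos (Fin.cons ρ σ')
      simp only [Fin.prod_univ_succ, Fin.cons_zero, Fin.cons_succ] at this
      have hrw : ∑ t ∈ T, c t * (h t 0 ρ * ∏ j : Fin m, h t j.succ (σ' j)) =
          ∑ t ∈ T, c t * h t 0 ρ * ∏ j : Fin m, h t j.succ (σ' j) :=
        Finset.sum_congr rfl fun t _ => by ring
      rw [hrw] at this
      linarith [this]
    rcases hadm t₁ ht₁ 0 with ⟨ρ₀, hρ₀⟩ | ⟨ρ, ρ', hneg⟩
    · -- a zero: restrict the first block to `ρ₀`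
      have hε' : ε * ((Perm.sign ρ₀ : ℤ) : ℝ) = 1 ∨ ε * ((Perm.sign ρ₀ : ℤ) : ℝ) = -1 := by
        rcases hε with rfl | rfl <;> rcases sign_real_eq_one_or ρ₀ with h1 | h1 <;> rw [h1] <;> norm_num
      have := ih (T.erase t₁) (fun t => c t * h t 0 ρ₀) (fun t j => h t j.succ)
        (ε * ((Perm.sign ρ₀ : ℤ) : ℝ)) hε'
        (fun t ht j => hadm t (Finset.mem_of_mem_erase ht) j.succ)
        (fun σ' => by
          rw [hsplit (fun t => c t * h t 0 ρ₀ * ∏ j, h t j.succ (σ' j))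
            (by rw [hρ₀, mul_zero, zero_mul])]
          exact heval ρ₀ σ')
      omega
    · -- no zero needed: eliminate `t₁` with the pair `ρ, ρ'`
      set a : ℝ := h t₁ 0 ρ' with ha
      set b : ℝ := h t₁ 0 ρ with hb
      set s : ℝ := ((Perm.sign ρ : ℤ) : ℝ) with hs
      set s' : ℝ := ((Perm.sign ρ' : ℤ) : ℝ) with hs'
      have hss : s * s = 1 := sign_real_mul_self ρ
      have hss' : s' * s' = 1 := sign_real_mul_self ρ'
      have hneg' : b * a * s * s' < 0 := hneg
      have := ih (T.erase t₁) (fun t => s * a * (c t * (a * h t 0 ρ - b * h t 0 ρ')))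
        (fun t j => h t j.succ) ε hε
        (fun t ht j => hadm t (Finset.mem_of_mem_erase ht) j.succ)
        (fun σ' => by
          set P : ι → ℝ := fun t => ∏ j, h t j.succ (σ' j) with hP
          set Psg : ℝ := ∏ j, ((Perm.sign (σ' j) : ℤ) : ℝ) with hPsg
          have hA := heval ρ σ'
          have hB := heval ρ' σ'
          rw [hsplit (fun t => s * a * (c t * (a * h t 0 ρ - b * h t 0 ρ')) * P t)
            (by rw [← ha, ← hb]; ring)]
          -- express the new sum through the two old ones
          have hsum : ∑ t ∈ T, s * a * (c t * (a * h t 0 ρ - b * h t 0 ρ')) * P t =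
              s * a * (a * ∑ t ∈ T, c t * h t 0 ρ * P t - b * ∑ t ∈ T, c t * h t 0 ρ' * P t) := by
            rw [Finset.mul_sum, Finset.mul_sum, ← Finset.sum_sub_distrib, Finset.mul_sum]
            exact Finset.sum_congr rfl fun t _ => by ring
          rw [hsum]
          set SA : ℝ := ∑ t ∈ T, c t * h t 0 ρ * P t with hSA
          set SB : ℝ := ∑ t ∈ T, c t * h t 0 ρ' * P t with hSB
          -- `X = ε s Π SA > 0`, `Y = ε s' Π SB > 0`
          have hX : 0 < ε * s * Psg * SA := hA
          have hY : 0 < ε * s' * Psg * SB := hB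
          have ha0 : a ≠ 0 := by
            intro h0; rw [h0, mul_zero, zero_mul, zero_mul] at hneg'; exact lt_irrefl _ hneg'
          have h1 : 0 < a * a * (ε * s * Psg * SA) := mul_pos (mul_self_pos.2 ha0) hX
          have h2 : 0 < -(b * a * s * s') * (ε * s' * Psg * SB) := mul_pos (neg_pos.2 hneg') hY
          have hid : ε * Psg * (s * a * (a * SA - b * SB)) =
              a * a * (ε * s * Psg * SA) + -(b * a * s * s') * (ε * s' * Psg * SB) := by
            linear_combination (ε * Psg * a * b * SB * s) * hss'
          rw [hid]
          linarith)
      omega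

end Summit.ValiantsHypothesis.ValiantsHypothesis.Theorems.SliceSignRank
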